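import Mathlib.LinearAlgebra.Matrix.PosDef
import Mathlib.LinearAlgebra.Matrix.Hermitian
import Mathlib.Algebra.Order.Star.Real
import Literature.Analysis.Fourier.FejerDyadicDecomposition
import HarnessLib

/-!
# Finite-range decomposition of lattice Green's functions by polynomial calculus

A **finite-range decomposition** of the Green's function `A⁻¹` of a positive finite-range lattice
operator `A` (a "generalised Laplacian") is a splitting `A⁻¹ = Σ_j C_j` into positive semidefinite
pieces `C_j` of finite range `∼ L^j` with the scaling of a single momentum shell; it is the starting
point of the Brydges–Slade / Bauerschmidt–Brydges–Slade renormalisation group and of the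
Adams–Kotecký–Müller approach to gradient models [cite: BrydgesGuadagniMitter2004, Thm. 1.1],
[cite: Bauerschmidt2013, Thm. 1.1–1.2], [cite: BauerschmidtBrydgesSlade2019, Ch. 3].  The published constructions
use averaging of Poisson kernels (BGM), the finite propagation speed of the wave equation
(Bauerschmidt; on the lattice this needs `A` to be a Markov generator) or elliptic regularity (AKM).

This file gives an EXACT and purely ALGEBRAIC dyadic finite-range decomposition valid for EVERY
symmetric matrix `A` with `0 ≤ A ≤ 4` (no sign condition on individual couplings), by evaluating the
dyadic Fejér telescoping identity of `Literature/Analysis/Fourier/FejerDyadicDecomposition.lean` at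
`B := 1 − A/2` (the would-be `cos Θ`, `A = 4 sin²(Θ/2)`):

  `A · Σ_{N<J} C_N + R_J = 1`,  `C_N := ¼ P_{2^N−1}(B)²`,  `R_J := P_{2^J−1}(B)/2^J`
  (`frd_identity`), where `P_M` is the Fejér–Chebyshev polynomial (`P_M(cos 2πx) = F_M(x)`);

* `C_N` is positive semidefinite for every symmetric `A` (a square: `posSemidef_frdPiece`), and
  `R_J = ¼(4 − A)·(Π_{i<J−1} T_{2^i}(B))²` is positive semidefinite when `A ≤ 4`
  (`frdRemainder_eq`, `posSemidef_frdRemainder`);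
* if `A` has range `≤ R` for a (pseudo-)distance `d` then `C_N` has range `≤ 2(2^N − 1)R` and `R_J`
  has range `≤ (2^J − 1)R` (`hasFiniteRange_frdPiece`, `hasFiniteRange_frdRemainder`) — finite
  propagation speed is here the trivial fact that a polynomial of degree `m` in `A` has range `mR`;
* every matrix commuting with `A` (translations, reflections, time reversal, …) commutes with all
  pieces (`commute_frdPiece`, `commute_frdRemainder`), so the decomposition inherits every symmetry
  of `A`;
* on an eigenvector `A v = 4 sin²(πx) v` the pieces act by the scalars `¼ F_{2^N−1}(x)²` and
  `F_{2^J−1}(x)/2^J` (`frdPiece_mulVec_of_eigen`, `frdRemainder_mulVec_of_eigen`), so the symbol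
  bounds `0 ≤ ¼F² ≤ min(4^{N−1}, 1/(64·4^N x⁴))`, `0 ≤ F/2^J ≤ min(1, 1/(4^{J+1}x²))` of that file give
  the single-shell scaling of each piece (in `d = 3`: `sup |C_N(x,y)| = O(2^{−N})` uniformly in the
  volume, by a Riemann sum over the Brillouin zone).

For a positive DEFINITE `A ≤ 4` this is the finite-range decomposition
`A⁻¹ = Σ_{N<J} C_N + A⁻¹R_J` (`frd_inverse`); on a torus (`A` with a zero mode) one applies
`frd_identity` on the orthogonal complement of the kernel, the last term `A⁺R_J` being the
"last-scale" covariance.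

## References

* [BrydgesGuadagniMitter2004] D. Brydges, G. Guadagni, P. Mitter, Finite range decomposition of
  Gaussian processes, J. Stat. Phys. 115 (2004) 415–449, doi:10.1023/b:joss.0000019818.81237.66.
* [Bauerschmidt2013] R. Bauerschmidt, A simple method for finite range decomposition of quadratic
  forms and Gaussian fields, Probab. Theory Relat. Fields 157 (2013) 817–845.
* [BauerschmidtBrydgesSlade2019] R. Bauerschmidt, D. Brydges, G. Slade, Introduction to a
  renormalisation group method, Lecture Notes in Math. 2242, Springer 2019, Ch. 3 "Finite-range
  decomposition", doi:10.1007/978-981-32-9593-3_3.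
-/

noncomputable section

open Finset Polynomial
open Literature.Analysis.Fourier.TrigApprox

namespace Literature.Analysis.Matrix

variable {V : Type*}

/-! ## Finite range of a matrix with respect to a pseudo-distance -/

/-- `A` has range `≤ R` for the "distance" `d : V → V → ℕ`: `A i j = 0` whenever `d i j > R`.
[cite: BauerschmidtBrydgesSlade2019, Def. 3.1.1 (finite-range property)] -/
def HasFiniteRange (d : V → V → ℕ) (R : ℕ) (A : _root_.Matrix V V ℝ) : Prop :=
  ∀ i j, R < d i j → A i j = 0

namespace HasFiniteRange

variable {d : V → V → ℕ} {R S : ℕ} {A B : _root_.Matrix V V ℝ}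

/-- Monotonicity in the range. [folklore] -/
theorem mono (h : HasFiniteRange d R A) (hRS : R ≤ S) : HasFiniteRange d S A :=
  fun i j hij => h i j (lt_of_le_of_lt hRS hij)

/-- The zero matrix has every range. [folklore] -/
theorem zero : HasFiniteRange d R (0 : _root_.Matrix V V ℝ) := fun _ _ _ => rfl

/-- The identity has range `0` (when `d i i = 0`). [folklore] -/
theorem one [DecidableEq V] (hd : ∀ i, d i i = 0) : HasFiniteRange d R (1 : _root_.Matrix V V ℝ) := by
  intro i j hij
  have hne : i ≠ j := by rintro rfl; rw [hd i] at hij; exact Nat.not_lt_zero _ hij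
  exact Matrix.one_apply_ne hne

/-- Sums. [folklore] -/
theorem add (hA : HasFiniteRange d R A) (hB : HasFiniteRange d R B) : HasFiniteRange d R (A + B) := by
  intro i j hij; simp [hA i j hij, hB i j hij]

/-- Differences. [folklore] -/
theorem sub (hA : HasFiniteRange d R A) (hB : HasFiniteRange d R B) : HasFiniteRange d R (A - B) := by
  intro i j hij; simp [hA i j hij, hB i j hij]

/-- Scalar multiples. [folklore] -/
theorem smul (hA : HasFiniteRange d R A) (c : ℝ) : HasFiniteRange d R (c • A) := by
  intro i j hij; simp [hA i j hij]

/-- Finite sums. [folklore] -/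
theorem sum {ι : Type*} (s : Finset ι) {F : ι → _root_.Matrix V V ℝ}
    (h : ∀ k ∈ s, HasFiniteRange d R (F k)) : HasFiniteRange d R (∑ k ∈ s, F k) := by
  intro i j hij
  rw [Matrix.sum_apply]
  exact Finset.sum_eq_zero fun k hk => h k hk i j hij

/-- **Products add ranges** (triangle inequality for `d`). [folklore] -/
theorem mul [Fintype V] (htri : ∀ i j k, d i k ≤ d i j + d j k) (hA : HasFiniteRange d R A)
    (hB : HasFiniteRange d S B) : HasFiniteRange d (R + S) (A * B) := by
  intro i k hik
  rw [Matrix.mul_apply]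
  refine Finset.sum_eq_zero fun j _ => ?_
  by_cases hij : R < d i j
  · rw [hA i j hij, zero_mul]
  · have hjk : S < d j k := by
      have := htri i j k
      have hij' : d i j ≤ R := not_lt.mp hij
      omega
    rw [hB j k hjk, mul_zero]

/-- Powers: `A^m` has range `m R`. [folklore] -/
theorem pow [Fintype V] [DecidableEq V] (htri : ∀ i j k, d i k ≤ d i j + d j k) (hd : ∀ i, d i i = 0)
    (hA : HasFiniteRange d R A) (m : ℕ) : HasFiniteRange d (m * R) (A ^ m) := by
  induction m with
  | zero => rw [pow_zero, zero_mul]; exact one hd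
  | succ m ih => rw [pow_succ, Nat.succ_mul]; exact ih.mul htri hA

/-- **Polynomials: `p(A)` has range `deg p · R`** — the algebraic "finite propagation speed". [folklore] -/
theorem aeval [Fintype V] [DecidableEq V] (htri : ∀ i j k, d i k ≤ d i j + d j k) (hd : ∀ i, d i i = 0)
    (hA : HasFiniteRange d R A) (p : ℝ[X]) :
    HasFiniteRange d (p.natDegree * R) (Polynomial.aeval A p) := by
  rw [Polynomial.aeval_eq_sum_range]
  refine sum _ fun k hk => ?_
  refine ((hA.pow htri hd k).smul _).mono ?_
  exact Nat.mul_le_mul_right _ (Nat.lt_succ_iff.mp (Finset.mem_range.mp hk))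

end HasFiniteRange

/-! ## Polynomial calculus in a symmetric matrix -/

section Calculus

variable [Fintype V] [DecidableEq V] {A B U : _root_.Matrix V V ℝ}

/-- A real polynomial in a symmetric matrix is symmetric. [folklore] -/
theorem isHermitian_aeval (hB : B.IsHermitian) (p : ℝ[X]) : (Polynomial.aeval B p).IsHermitian := by
  rw [Polynomial.aeval_eq_sum_range]
  unfold Matrix.IsHermitian
  rw [Matrix.conjTranspose_sum]
  refine Finset.sum_congr rfl fun k _ => ?_
  rw [Matrix.conjTranspose_smul, Matrix.conjTranspose_pow, hB.eq, star_trivial]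

/-- Polynomials in the same matrix commute. [folklore] -/
theorem commute_aeval_aeval (B : _root_.Matrix V V ℝ) (p q : ℝ[X]) :
    Commute (Polynomial.aeval B p) (Polynomial.aeval B q) := by
  change Polynomial.aeval B p * Polynomial.aeval B q = Polynomial.aeval B q * Polynomial.aeval B p
  rw [← map_mul, ← map_mul, mul_comm]

/-- Whatever commutes with `B` commutes with every polynomial in `B`. [folklore] -/
theorem commute_aeval_of_commute (h : Commute U B) (p : ℝ[X]) : Commute U (Polynomial.aeval B p) := by
  rw [Polynomial.aeval_eq_sum_range]
  exact Commute.sum_right _ _ _ fun k _ => (h.pow_right k).smul_right _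

/-- `p(A) v = p(μ) v` on an eigenvector `A v = μ v`. [folklore] -/
theorem aeval_mulVec_of_eigen {v : V → ℝ} {μ : ℝ} (hv : A.mulVec v = μ • v) (p : ℝ[X]) :
    (Polynomial.aeval A p).mulVec v = (p.eval μ) • v := by
  have hpow : ∀ k : ℕ, (A ^ k).mulVec v = μ ^ k • v := by
    intro k
    induction k with
    | zero => simp
    | succ k ih => rw [pow_succ, ← Matrix.mulVec_mulVec, hv, Matrix.mulVec_smul, ih, smul_smul,
        pow_succ, mul_comm]
  rw [Polynomial.aeval_eq_sum_range, Polynomial.eval_eq_sum_range, Matrix.sum_mulVec, Finset.sum_smul]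
  refine Finset.sum_congr rfl fun k _ => ?_
  rw [Matrix.smul_mulVec, hpow, smul_smul]

omit [Fintype V] [DecidableEq V] in
/-- A finite sum of positive semidefinite matrices is positive semidefinite. [folklore] -/
theorem posSemidef_sum {ι : Type*} (s : Finset ι) {F : ι → _root_.Matrix V V ℝ}
    (h : ∀ k ∈ s, (F k).PosSemidef) : (∑ k ∈ s, F k).PosSemidef := by
  classical
  induction s using Finset.induction_on with
  | empty => simpa using Matrix.PosSemidef.zero
  | insert a s ha ih =>
    rw [Finset.sum_insert ha]
    exact (h a (Finset.mem_insert_self a s)).add (ih fun k hk => h k (Finset.mem_insert_of_mem hk))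

end Calculus

/-! ## The dyadic Fejér finite-range decomposition -/

section FRD

variable [Fintype V] [DecidableEq V] (A : _root_.Matrix V V ℝ) {U : _root_.Matrix V V ℝ}

/-- `B := 1 − A/2` — for `A = 4 sin²(Θ/2)` this is `cos Θ`. [cite: Bauerschmidt2013, §3 (discrete case)] -/
def frdCos : _root_.Matrix V V ℝ := 1 - (1 / 2 : ℝ) • A

/-- **The `N`-th finite-range piece** `C_N := ¼ · P_{2^N−1}(B)²` (symbol `¼ F_{2^N−1}(x)²` at
`A = 4 sin²(πx)`; range `< 2^{N+1}·range(A)`). [cite: BrydgesGuadagniMitter2004, Thm. 1.1] -/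
def frdPiece (N : ℕ) : _root_.Matrix V V ℝ :=
  (1 / 4 : ℝ) • (Polynomial.aeval (frdCos A) (fejerPoly (2 ^ N - 1))) ^ 2

/-- **The remainder after `J` scales** `R_J := P_{2^J−1}(B)/2^J` (symbol `F_{2^J−1}(x)/2^J ∈ [0,1]`).
[cite: BrydgesGuadagniMitter2004, Thm. 1.1] -/
def frdRemainder (J : ℕ) : _root_.Matrix V V ℝ :=
  (1 / 2 ^ J : ℝ) • Polynomial.aeval (frdCos A) (fejerPoly (2 ^ J - 1))

omit [Fintype V] in
/-- `1 − B = A/2`. [folklore] -/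
theorem one_sub_frdCos : 1 - frdCos A = (1 / 2 : ℝ) • A := by
  simp [frdCos]

omit [Fintype V] in
/-- `½ + ½B = ¼(4 − A)`. [folklore] -/
theorem half_one_add_half_frdCos :
    (1 / 2 : ℝ) • (1 : _root_.Matrix V V ℝ) + (1 / 2 : ℝ) • frdCos A
      = (1 / 4 : ℝ) • ((4 : ℝ) • (1 : _root_.Matrix V V ℝ) - A) := by
  unfold frdCos
  rw [smul_sub, smul_sub, smul_smul, smul_smul, ← add_sub_assoc, ← add_smul]
  norm_num

/-- **The exact decomposition identity**: `A · Σ_{N<J} C_N + R_J = 1` for EVERY square matrix `A`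
and every number of scales `J`. [cite: BrydgesGuadagniMitter2004, Thm. 1.1 (form)] -/
theorem frd_identity (J : ℕ) :
    A * ∑ N ∈ Finset.range J, frdPiece A N + frdRemainder A J = 1 := by
  have h := congrArg (Polynomial.aeval (frdCos A)) (fejerPoly_dyadic_identity J)
  simp only [map_add, map_mul, map_sub, map_one, map_sum, map_pow, Polynomial.aeval_C,
    Polynomial.aeval_X, Algebra.algebraMap_eq_smul_one] at h
  rw [one_sub_frdCos, smul_one_mul, smul_one_mul, smul_smul,
    show (1 / 2 : ℝ) * (1 / 2) = 1 / 4 by norm_num] at h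
  rw [← h]
  unfold frdPiece frdRemainder
  congr 1
  rw [Finset.mul_sum, Finset.mul_sum]
  refine Finset.sum_congr rfl fun N _ => ?_
  rw [mul_smul_comm, smul_mul_assoc]

/-- For an invertible `A`: `A⁻¹ = Σ_{N<J} C_N + A⁻¹ R_J`. [cite: BrydgesGuadagniMitter2004, Thm. 1.1 (form)] -/
theorem frd_inverse (J : ℕ) (hA : IsUnit A.det) :
    A⁻¹ = ∑ N ∈ Finset.range J, frdPiece A N + A⁻¹ * frdRemainder A J := by
  have h := frd_identity A J
  have h2 := congrArg (fun M => A⁻¹ * M) h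
  simp only [mul_add, ← mul_assoc, Matrix.nonsing_inv_mul _ hA, one_mul, mul_one] at h2
  exact h2.symm

variable {A}

omit [Fintype V] in
/-- `B` is symmetric when `A` is. [folklore] -/
theorem isHermitian_frdCos (hA : A.IsHermitian) : (frdCos A).IsHermitian := by
  unfold frdCos
  exact Matrix.isHermitian_one.sub (hA.smul (by simp))

/-- **Each piece is positive semidefinite** (it is a quarter of the square of a symmetric matrix) —
for EVERY symmetric `A`, with no sign condition on its couplings. [cite: Bauerschmidt2013, Thm. 1.2 (i)] -/
theorem posSemidef_frdPiece (hA : A.IsHermitian) (N : ℕ) : (frdPiece A N).PosSemidef := by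
  unfold frdPiece
  have hM := isHermitian_aeval (isHermitian_frdCos hA) (fejerPoly (2 ^ N - 1))
  have hsq : (Polynomial.aeval (frdCos A) (fejerPoly (2 ^ N - 1))) ^ 2
      = (Polynomial.aeval (frdCos A) (fejerPoly (2 ^ N - 1))).conjTranspose
          * Polynomial.aeval (frdCos A) (fejerPoly (2 ^ N - 1)) := by
    rw [sq, hM.eq]
  rw [hsq]
  exact (Matrix.posSemidef_conjTranspose_mul_self _).smul (by norm_num)

/-- The partial sums `Σ_{N<J} C_N` are positive semidefinite. [cite: Bauerschmidt2013, Thm. 1.2 (i)] -/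
theorem posSemidef_sum_frdPiece (hA : A.IsHermitian) (J : ℕ) :
    (∑ N ∈ Finset.range J, frdPiece A N).PosSemidef :=
  posSemidef_sum _ fun N _ => posSemidef_frdPiece hA N

/-- `R_0 = 1`. [folklore] -/
theorem frdRemainder_zero (A : _root_.Matrix V V ℝ) : frdRemainder A 0 = 1 := by
  simp [frdRemainder]

/-- **Square form of the remainder**: for `J ≥ 1`,
`R_J = ¼(4 − A) · (Π_{i<J−1} T_{2^i}(B))²`. [folklore] -/
theorem frdRemainder_eq (A : _root_.Matrix V V ℝ) {J : ℕ} (hJ : 1 ≤ J) :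
    frdRemainder A J = ((1 / 4 : ℝ) • ((4 : ℝ) • (1 : _root_.Matrix V V ℝ) - A))
      * (Polynomial.aeval (frdCos A)
          (∏ i ∈ Finset.range (J - 1), Polynomial.Chebyshev.T ℝ (2 ^ i))) ^ 2 := by
  have h := congrArg (Polynomial.aeval (frdCos A)) (fejerPoly_two_pow_eq_sq J hJ)
  simp only [map_mul, map_add, map_one, map_pow, Polynomial.aeval_C, Polynomial.aeval_X,
    Algebra.algebraMap_eq_smul_one] at h
  unfold frdRemainder
  rw [smul_one_mul] at h
  rw [h, smul_one_mul, smul_add, half_one_add_half_frdCos]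

/-- **The remainder is positive semidefinite when `A ≤ 4`** (Loewner order).
[cite: Bauerschmidt2013, Thm. 1.2 (i)] -/
theorem posSemidef_frdRemainder (hA : A.IsHermitian)
    (h4 : ((4 : ℝ) • (1 : _root_.Matrix V V ℝ) - A).PosSemidef) (J : ℕ) :
    (frdRemainder A J).PosSemidef := by
  rcases Nat.eq_zero_or_pos J with rfl | hJ
  · rw [frdRemainder_zero]; exact Matrix.PosSemidef.one
  rw [frdRemainder_eq A hJ]
  set M := Polynomial.aeval (frdCos A) (∏ i ∈ Finset.range (J - 1), Polynomial.Chebyshev.T ℝ (2 ^ i))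
    with hMdef
  set P := (1 / 4 : ℝ) • ((4 : ℝ) • (1 : _root_.Matrix V V ℝ) - A) with hPdef
  have hM : M.IsHermitian := isHermitian_aeval (isHermitian_frdCos hA) _
  have hP : P.PosSemidef := h4.smul (by norm_num)
  -- `P` is a polynomial in `B`, hence commutes with `M`
  have hPpoly : P = Polynomial.aeval (frdCos A) (Polynomial.C (1 / 2 : ℝ) * (1 + X)) := by
    simp only [map_mul, map_add, map_one, Polynomial.aeval_C, Polynomial.aeval_X,
      Algebra.algebraMap_eq_smul_one]
    rw [smul_one_mul, smul_add, half_one_add_half_frdCos]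
  have hcomm : Commute P M := by rw [hPpoly]; exact commute_aeval_aeval _ _ _
  have : P * M ^ 2 = M.conjTranspose * P * M := by
    rw [hM.eq, sq, ← mul_assoc, hcomm.eq]
  rw [this]
  exact hP.conjTranspose_mul_mul_same M

/-! ### Symmetries are inherited -/

/-- Whatever commutes with `A` commutes with `B`. [folklore] -/
theorem commute_frdCos (h : Commute U A) : Commute U (frdCos A) :=
  (Commute.one_right U).sub_right (h.smul_right _)

/-- **Whatever commutes with `A` commutes with every piece `C_N`** (translations, lattice
reflections, time reversal, internal symmetries). [cite: Bauerschmidt2013, Thm. 1.2 (iii)] -/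
theorem commute_frdPiece (h : Commute U A) (N : ℕ) : Commute U (frdPiece A N) :=
  ((commute_aeval_of_commute (commute_frdCos h) _).pow_right 2).smul_right _

/-- Whatever commutes with `A` commutes with the remainder `R_J`. [cite: Bauerschmidt2013, Thm. 1.2 (iii)] -/
theorem commute_frdRemainder (h : Commute U A) (J : ℕ) : Commute U (frdRemainder A J) :=
  (commute_aeval_of_commute (commute_frdCos h) _).smul_right _

/-! ### Finite range -/

variable {d : V → V → ℕ} {R : ℕ}

omit [Fintype V] in
/-- `B = 1 − A/2` has the range of `A`. [folklore] -/
theorem hasFiniteRange_frdCos (hd : ∀ i, d i i = 0) (hA : HasFiniteRange d R A) :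
    HasFiniteRange d R (frdCos A) :=
  (HasFiniteRange.one hd).sub (hA.smul _)

/-- **`C_N` has range `≤ 2(2^N − 1)·R`.** [cite: BrydgesGuadagniMitter2004, Thm. 1.1 (finite range)] -/
theorem hasFiniteRange_frdPiece (htri : ∀ i j k, d i k ≤ d i j + d j k) (hd : ∀ i, d i i = 0)
    (hA : HasFiniteRange d R A) (N : ℕ) :
    HasFiniteRange d (2 * (2 ^ N - 1) * R) (frdPiece A N) := by
  unfold frdPiece
  have hB := hasFiniteRange_frdCos hd hA
  have h1 : HasFiniteRange d ((2 ^ N - 1) * R) (Polynomial.aeval (frdCos A) (fejerPoly (2 ^ N - 1))) :=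
    (hB.aeval htri hd _).mono (Nat.mul_le_mul_right _ (natDegree_fejerPoly_le _))
  have h2 := (h1.mul htri h1).smul (1 / 4 : ℝ)
  rw [← sq] at h2
  exact h2.mono (by ring_nf; rfl)

/-- **`R_J` has range `≤ (2^J − 1)·R`.** [cite: BrydgesGuadagniMitter2004, Thm. 1.1 (finite range)] -/
theorem hasFiniteRange_frdRemainder (htri : ∀ i j k, d i k ≤ d i j + d j k) (hd : ∀ i, d i i = 0)
    (hA : HasFiniteRange d R A) (J : ℕ) :
    HasFiniteRange d ((2 ^ J - 1) * R) (frdRemainder A J) := by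
  unfold frdRemainder
  exact (((hasFiniteRange_frdCos hd hA).aeval htri hd _).mono
    (Nat.mul_le_mul_right _ (natDegree_fejerPoly_le _))).smul _

/-- The partial sums `Σ_{N<J} C_N` have range `≤ 2(2^{J−1} − 1)·R < 2^J R`. [folklore] -/
theorem hasFiniteRange_sum_frdPiece (htri : ∀ i j k, d i k ≤ d i j + d j k) (hd : ∀ i, d i i = 0)
    (hA : HasFiniteRange d R A) (J : ℕ) :
    HasFiniteRange d (2 * (2 ^ (J - 1) - 1) * R) (∑ N ∈ Finset.range J, frdPiece A N) := by
  refine HasFiniteRange.sum _ fun N hN => (hasFiniteRange_frdPiece htri hd hA N).mono ?_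
  have hN' : N ≤ J - 1 := by have := Finset.mem_range.mp hN; omega
  have : 2 ^ N ≤ 2 ^ (J - 1) := Nat.pow_le_pow_right (by norm_num) hN'
  apply Nat.mul_le_mul_right
  omega

/-! ### The symbol on eigenvectors -/

/-- `cos(2πx) = 1 − 2 sin²(πx)`. [folklore] -/
private theorem cos_two_pi_mul_eq (x : ℝ) : Real.cos (2 * Real.pi * x) = 1 - 2 * Real.sin (Real.pi * x) ^ 2 := by
  rw [show 2 * Real.pi * x = 2 * (Real.pi * x) by ring, Real.cos_two_mul, Real.cos_sq']
  ring

/-- On an eigenvector `A v = 4 sin²(πx) v`, `B v = cos(2πx) v`. [folklore] -/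
theorem frdCos_mulVec_of_eigen {v : V → ℝ} {x : ℝ}
    (hv : A.mulVec v = (4 * Real.sin (Real.pi * x) ^ 2) • v) :
    (frdCos A).mulVec v = Real.cos (2 * Real.pi * x) • v := by
  unfold frdCos
  rw [Matrix.sub_mulVec, Matrix.one_mulVec, Matrix.smul_mulVec, hv, smul_smul,
    cos_two_pi_mul_eq, sub_smul, one_smul]
  congr 1
  rw [show (1 / 2 : ℝ) * (4 * Real.sin (Real.pi * x) ^ 2) = 2 * Real.sin (Real.pi * x) ^ 2 by ring]

/-- **Symbol of the pieces**: on an eigenvector `A v = 4 sin²(πx) v`,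
`C_N v = ¼ F_{2^N−1}(x)² v`. [cite: Bauerschmidt2013, Thm. 1.2 (ii) (form)] -/
theorem frdPiece_mulVec_of_eigen {v : V → ℝ} {x : ℝ}
    (hv : A.mulVec v = (4 * Real.sin (Real.pi * x) ^ 2) • v) (N : ℕ) :
    (frdPiece A N).mulVec v = (1 / 4 * fejer (2 ^ N - 1) x ^ 2) • v := by
  unfold frdPiece
  have hB := frdCos_mulVec_of_eigen hv
  have h1 := aeval_mulVec_of_eigen hB (fejerPoly (2 ^ N - 1))
  rw [fejerPoly_eval_cos] at h1
  rw [Matrix.smul_mulVec, sq, ← Matrix.mulVec_mulVec, h1, Matrix.mulVec_smul, h1, smul_smul,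
    smul_smul]
  congr 1
  ring

/-- **Symbol of the remainder**: on an eigenvector `A v = 4 sin²(πx) v`, `R_J v = (F_{2^J−1}(x)/2^J) v`.
[cite: Bauerschmidt2013, Thm. 1.2 (ii) (form)] -/
theorem frdRemainder_mulVec_of_eigen {v : V → ℝ} {x : ℝ}
    (hv : A.mulVec v = (4 * Real.sin (Real.pi * x) ^ 2) • v) (J : ℕ) :
    (frdRemainder A J).mulVec v = (fejer (2 ^ J - 1) x / 2 ^ J) • v := by
  unfold frdRemainder
  have h1 := aeval_mulVec_of_eigen (frdCos_mulVec_of_eigen hv) (fejerPoly (2 ^ J - 1))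
  rw [fejerPoly_eval_cos] at h1
  rw [Matrix.smul_mulVec, h1, smul_smul]
  congr 1
  ring

end FRD

end Literature.Analysis.Matrix

end
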